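import Literature.IUT.LogThetaLattice.BiCoresProp39iiStripJunction
import Literature.IUT.LogVolume.HaarTransport
import HarnessLib

/-!
# [IUTchIII] Proposition 3.9 (ii) — the GENUINE reading of the log-shell category: containers with integral
# structures, isomorphisms = bicontinuous additive isomorphisms carrying the integral structure onto the
# integral structure (the hypothesis `hU` of `prop39ii_monoAnalyticCompat_of_integralStructures` by construction)

abc-iut cell, layer L6, wave-4 discharge seat abc-iut-w4-d005 (gen 4), NV register row «LOGSHELL-READING-GENUINE»
(= gen-3 HANDOFF #2 recommended row (a); L6-lead §F v1.19ac: GENUINE NV upgrades are the open door). ONE small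
definition (`LogShellContainer`, its groupoid structure and forgetful reading) — a POST-FREEZE DEFINITION (reading
(ii): not a Cor. 3.12 adjudication artefact until stamped); everything else is proved.

S. Mochizuki, *Inter-universal Teichmüller Theory III*, kurims manuscript (May 2020) [claim key Mochizuki2012,
status disputed (D-0012)], read on the cell render `lit/renders/IUTchIII-kurims-url-4b091feeb646`:
* Prop. 1.2 (vi) p. 32: the poly-isomorphism `log(†𝒟^⊢_v) ⥲ log(†𝓕^{⊢×μ}_v)` "of topological modules" is
  "compatible … with the log-shells"; (viii) p. 33; Prop. 3.9 (ii) p. 116: the mono-analytic log-volumes are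
  "compatible with the log-volumes obtained in (i), relative to the natural poly-isomorphisms of Proposition 3.2,
  (i)" — i.e. the isomorphisms of the log-shell category `Sh` are isomorphisms of topological modules carrying
  the integral structure / log-shell onto the integral structure / log-shell.
* S. Mochizuki, *Topics in Absolute Anabelian Geometry III*, Prop. 5.7 (i) p. 137 (integral structures, the
  normalised Haar log-volume) [cite: MochizukiAbsTopIII2015, Prop. 5.7 (i) p. 137]; campaign-S `IntegralStructure`,
  `IntegralStructure.logVolume`, `logVolume_image_equiv` (Haar transport) — consumed BY NAME.

WHAT THIS FILE DOES. abc-iut-w4-d005 gen 3's `BiCoresProp39iiStripJunction.lean` (p425805) §4 proves Prop. 3.9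
(ii)'s compatibility along EVERY poly-isomorphism of any category `C` read (`U : C ⥤ Type`) in containers with
integral structures, UNDER the hypothesis `hU`: every isomorphism of `C` reads as a bicontinuous additive
isomorphism carrying `Λ_X` onto `Λ_Y`. Here that hypothesis is DISCHARGED BY CONSTRUCTION for the genuine reading:
* `LogShellContainer` — a topological abelian group (Borel measurable structure) WITH an integral structure;
  morphisms `X ⟶ Y` := bicontinuous additive isomorphisms `φ` with `φ(Λ_X) = Λ_Y` (a groupoid: `isIso_hom`,
  `inv_iso`); `forget` — the reading on underlying types;
* `reading_hU` — p425805's hypothesis holds with NO hypothesis; hence `logVolume_iso_invariant`,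
  `prop39ii_genuine` (abc-iut-L6-t4's `Prop39ii_monoAnalyticCompat` along EVERY poly-isomorphism of genuine
  containers, zero hypotheses) and `prop39ii_genuine_full` (in particular along the FULL poly-isomorphism);
* NON-DEGENERACY (the reading is not the identity-only toy): `ofLocalField` (a nonarchimedean local field with
  `Λ = 𝒪_k`, campaign-S `unitBallStructure`), `negIso` (`x ↦ −x` is a non-identity automorphism whenever `k` has
  characteristic `≠ 2`, `negIso_ne_id`), `isoOfNormPreserving` (every norm-preserving bicontinuous additive
  automorphism — e.g. a continuous field automorphism of a Galois extension — is a morphism), and the local-field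
  instance of Prop. 3.9 (ii) `prop39ii_localField_full` / `localLogVolume_eq_of_mem_full`: along the FULL
  poly-isomorphism of the container `(k, 𝒪_k)` the normalised log-volume `μ^log_k` is invariant.

HONEST SCOPE: this is the CONTAINER-level reading (one topological module per object). The cell's strip-level
frame (`BiCoricData.Sh`, `StripFrame.ofKits`) is instantiated against it only through p425805's generic lemmas
(`BiCoricData.prop39ii_monoHolAt_of_integralStructures` with `U :=` a functor into `LogShellContainer ⋙ forget`);
no claim is made that a given `BiCoricKit`'s `Sh` IS this category. Nothing here takes a side on [IUTchIII]
Cor. 3.12; typed ≠ endorsed; what is proved is Haar-measure transport.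
-/

noncomputable section

namespace Literature.IUT.LogThetaLattice

open CategoryTheory Set Metric
open Literature.IUT.HodgeTheaters Literature.IUT.LogVolume

universe u

/-! ### 1. Genuine log-shell containers and their groupoid -/

/-- A **genuine log-shell container**: a topological abelian group `V` (with its Borel measurable structure)
equipped with an integral structure `Λ ⊆ V` — a compact open additive subgroup ([AbsTopIII] Prop. 5.7 (i);
the "integral structures" / log-shells of [IUTchIII] Prop. 1.2 (vi), Prop. 3.1 (ii), Prop. 3.9 (i)(ii)).
[claim: Mochizuki2012, status: disputed] -/
structure LogShellContainer : Type (u + 1) where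
  /-- the underlying topological module `V` (e.g. `k~(G)`, `𝓘^ℚ(−)`, `log(†𝒟^⊢_v)`) -/
  carrier : Type u
  [addCommGroup : AddCommGroup carrier]
  [topologicalSpace : TopologicalSpace carrier]
  [isTopologicalAddGroup : IsTopologicalAddGroup carrier]
  [measurableSpace : MeasurableSpace carrier]
  [borelSpace : BorelSpace carrier]
  /-- the integral structure `Λ ⊆ V` (log-shell / ring of integers) -/
  Λ : IntegralStructure carrier

attribute [instance] LogShellContainer.addCommGroup LogShellContainer.topologicalSpace
  LogShellContainer.isTopologicalAddGroup LogShellContainer.measurableSpace LogShellContainer.borelSpace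

namespace LogShellContainer

variable {X Y Z : LogShellContainer.{u}}

/-- A morphism of genuine log-shell containers: a bicontinuous additive isomorphism carrying the integral
structure ONTO the integral structure ("isomorphisms of topological modules … compatible with the log-shells",
[IUTchIII] Prop. 1.2 (vi) p. 32). [claim: Mochizuki2012, status: disputed] -/
@[ext]
structure Hom (X Y : LogShellContainer.{u}) : Type u where
  /-- the underlying bicontinuous additive isomorphism -/
  iso : X.carrier ≃ₜ+ Y.carrier
  /-- it carries `Λ_X` onto `Λ_Y` -/
  image_eq : iso '' (X.Λ : Set X.carrier) = (Y.Λ : Set Y.carrier)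

/-- The identity morphism. [claim: Mochizuki2012, status: disputed] -/
def Hom.id (X : LogShellContainer.{u}) : Hom X X :=
  ⟨ContinuousAddEquiv.refl X.carrier, by simp⟩

/-- Composition of morphisms (composition of the isomorphisms; the images compose).
[claim: Mochizuki2012, status: disputed] -/
def Hom.comp (f : Hom X Y) (g : Hom Y Z) : Hom X Z :=
  ⟨f.iso.trans g.iso, by
    rw [ContinuousAddEquiv.coe_trans, Set.image_comp, f.image_eq, g.image_eq]⟩

/-- **The genuine log-shell category**: objects = containers with integral structures, morphisms = bicontinuous
additive isomorphisms respecting the integral structures (a groupoid). [claim: Mochizuki2012, status: disputed] -/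
instance : Category LogShellContainer.{u} where
  Hom X Y := Hom X Y
  id X := Hom.id X
  comp f g := Hom.comp f g
  id_comp f := by apply Hom.ext; ext x; rfl
  comp_id f := by apply Hom.ext; ext x; rfl
  assoc f g h := by apply Hom.ext; ext x; rfl

/-- Unfolding: the isomorphism underlying a composite. [claim: Mochizuki2012, status: disputed] -/
@[simp] theorem comp_iso (f : X ⟶ Y) (g : Y ⟶ Z) : (f ≫ g).iso = f.iso.trans g.iso := rfl

/-- Unfolding: the isomorphism underlying the identity. [claim: Mochizuki2012, status: disputed] -/
@[simp] theorem id_iso (X : LogShellContainer.{u}) :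
    (𝟙 X : X ⟶ X).iso = ContinuousAddEquiv.refl X.carrier := rfl

/-- The inverse morphism (inverse isomorphism; it carries `Λ_Y` back onto `Λ_X`).
[claim: Mochizuki2012, status: disputed] -/
def Hom.symm (f : X ⟶ Y) : Y ⟶ X :=
  ⟨f.iso.symm, by
    rw [← f.image_eq, ← Set.image_comp]
    simp⟩

/-- Every morphism is invertible: `f.symm ≫ f = 𝟙`. [claim: Mochizuki2012, status: disputed] -/
@[simp] theorem symm_comp (f : X ⟶ Y) : Hom.symm f ≫ f = 𝟙 Y := by
  apply Hom.ext; ext y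
  show f.iso (f.iso.symm y) = y
  exact f.iso.apply_symm_apply y

/-- Every morphism is invertible: `f ≫ f.symm = 𝟙`. [claim: Mochizuki2012, status: disputed] -/
@[simp] theorem comp_symm (f : X ⟶ Y) : f ≫ Hom.symm f = 𝟙 X := by
  apply Hom.ext; ext x
  show f.iso.symm (f.iso x) = x
  exact f.iso.symm_apply_apply x

/-- The genuine log-shell category is a GROUPOID: every morphism is an isomorphism.
[claim: Mochizuki2012, status: disputed] -/
theorem isIso_hom (f : X ⟶ Y) : IsIso f :=
  ⟨⟨Hom.symm f, comp_symm f, symm_comp f⟩⟩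

/-- A morphism packaged as an isomorphism of the category. [claim: Mochizuki2012, status: disputed] -/
def isoOfHom (f : X ⟶ Y) : X ≅ Y :=
  ⟨f, Hom.symm f, comp_symm f, symm_comp f⟩

/-- Unfolding `isoOfHom`. [claim: Mochizuki2012, status: disputed] -/
@[simp] theorem isoOfHom_hom (f : X ⟶ Y) : (isoOfHom f).hom = f := rfl

/-! ### 2. The reading and p425805's hypothesis `hU`, discharged by construction -/

/-- **The genuine READING** of the log-shell category on underlying types (`U` of p425805 §1/§4): object ↦ its
carrier, morphism ↦ the underlying function. An `abbrev`, so that `forget.obj X` is `X.carrier` for instance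
search. [claim: Mochizuki2012, status: disputed] -/
abbrev forget : LogShellContainer.{u} ⥤ Type u where
  obj X := X.carrier
  map f := TypeCat.ofHom ⇑f.iso
  map_id X := by rfl
  map_comp f g := by rfl

/-- The reading of an isomorphism is the underlying function of its `hom`. [claim: Mochizuki2012, status: disputed] -/
theorem forget_mapIso_hom (e : X ≅ Y) :
    (⇑(forget.mapIso e).hom : X.carrier → Y.carrier) = (⇑e.hom.iso : X.carrier → Y.carrier) :=
  rfl

/-- **IUTchIII:Prop3.9(ii)** (kurims p.116) — **the hypothesis `hU` of p425805's
`prop39ii_monoAnalyticCompat_of_integralStructures` holds for the genuine reading with NO hypothesis**: every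
isomorphism of genuine log-shell containers reads as a bicontinuous additive isomorphism carrying `Λ_X` onto
`Λ_Y` — by definition of the morphisms. [claim: Mochizuki2012, status: disputed] -/
theorem reading_hU {X Y : LogShellContainer.{u}} (e : X ≅ Y) :
    ∃ φ : X.carrier ≃ₜ+ Y.carrier,
      (⇑φ : X.carrier → Y.carrier) = (forget.mapIso e).hom ∧
        φ '' (X.Λ : Set X.carrier) = (Y.Λ : Set Y.carrier) :=
  ⟨e.hom.iso, (forget_mapIso_hom e).symm, e.hom.image_eq⟩

/-- **IUTchIII:Prop3.9(ii)** (kurims p.116) — iso-invariance of the `Λ`-normalised Haar log-volume along EVERY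
isomorphism of genuine containers, zero hypotheses (p425805 `isoInvariant_logVolume_of_integralStructures` ∘
`reading_hU`; campaign-S `IntegralStructure.logVolume_image_equiv`). [claim: Mochizuki2012, status: disputed] -/
theorem logVolume_iso_invariant {X Y : LogShellContainer.{u}} (e : X ≅ Y) (T : Set X.carrier) :
    X.Λ.logVolume T = Y.Λ.logVolume ((forget.mapIso e).toEquiv '' T) :=
  isoInvariant_logVolume_of_integralStructures forget (fun X => X.Λ) (fun e => reading_hU e) e T

/-- **IUTchIII:Prop3.9(ii)** (kurims p.116) — **Prop 3.9 (ii) for the GENUINE reading, zero hypotheses**: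
abc-iut-L6-t4's `Prop39ii_monoAnalyticCompat` holds for the reading of EVERY poly-isomorphism between genuine
log-shell containers, with the `Λ`-normalised log-volumes on both sides ("compatible with the log-volumes
obtained in (i), relative to the natural poly-isomorphisms"). [claim: Mochizuki2012, status: disputed] -/
theorem prop39ii_genuine {X Y : LogShellContainer.{u}} (P : PolyIso X Y) :
    Prop39ii_monoAnalyticCompat ((fun e : X ≅ Y => (forget.mapIso e).toEquiv) '' P) X.Λ.logVolume Y.Λ.logVolume :=
  prop39ii_monoAnalyticCompat_of_integralStructures forget (fun X => X.Λ) (fun e => reading_hU e) P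

/-- **IUTchIII:Prop3.9(ii)** (kurims p.116) — in particular along the FULL poly-isomorphism (Def. 3.8 (ii)'s
full poly-isomorphisms; `PolyIso.full = Set.univ`). [claim: Mochizuki2012, status: disputed] -/
theorem prop39ii_genuine_full (X Y : LogShellContainer.{u}) :
    Prop39ii_monoAnalyticCompat ((fun e : X ≅ Y => (forget.mapIso e).toEquiv) '' (Set.univ : PolyIso X Y))
      X.Λ.logVolume Y.Λ.logVolume :=
  prop39ii_genuine Set.univ

/-- **IUTchIII:Prop3.9(ii)** (kurims p.116), pointwise form: for every morphism `f` of genuine containers and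
every region `T`, `μ^log_{Λ_Y}(f(T)) = μ^log_{Λ_X}(T)`. [claim: Mochizuki2012, status: disputed] -/
theorem logVolume_image_hom (f : X ⟶ Y) (T : Set X.carrier) :
    Y.Λ.logVolume (f.iso '' T) = X.Λ.logVolume T :=
  X.Λ.logVolume_image_equiv Y.Λ f.iso f.image_eq T

/-! ### 3. Non-degeneracy: local fields, negation, norm-preserving automorphisms -/

section LocalField

variable (K : Type u) [NontriviallyNormedField K]

/-- A norm-preserving bicontinuous additive bijection maps the closed unit ball ONTO the closed unit ball.
[folklore] -/
private theorem image_closedBall_eq (φ : K ≃ₜ+ K) (hφ : ∀ x, ‖φ x‖ = ‖x‖) :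
    φ '' closedBall (0 : K) 1 = closedBall (0 : K) 1 := by
  ext y
  simp only [mem_image, mem_closedBall, dist_zero_right]
  constructor
  · rintro ⟨x, hx, rfl⟩
    rwa [hφ]
  · intro hy
    exact ⟨φ.symm y, by rw [← hφ, ContinuousAddEquiv.apply_symm_apply]; exact hy,
      ContinuousAddEquiv.apply_symm_apply φ y⟩

/-- Negation as a bicontinuous additive automorphism of `k` (the action of the unit `−1 ∈ 𝒪_k^×`).
[cite: MochizukiAbsTopIII2015, Prop. 5.7 (i)(b) p. 138] -/
def negEquiv : K ≃ₜ+ K :=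
  { AddEquiv.neg K with
    continuous_toFun := continuous_neg
    continuous_invFun := continuous_neg }

/-- `negEquiv` is `x ↦ −x` (`−1 ∈ 𝒪_k^×` acts on `k`; "if `x ∈ 𝒪_k^×`, then `μ^log_k(x·A) = μ^log_k(A)`").
[cite: MochizukiAbsTopIII2015, Prop. 5.7 (i)(b) p. 138] -/
@[simp] theorem negEquiv_apply (x : K) : negEquiv K x = -x := rfl

variable [IsUltrametricDist K] [ProperSpace K]

/-- **The container of a nonarchimedean local field**: `(k, 𝒪_k)` with campaign-S `unitBallStructure`
(`𝒪_k = {‖x‖ ≤ 1}`, [AbsTopIII] Prop. 5.7 (i)); Borel structure := `borel k`.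
[claim: Mochizuki2012, status: disputed] -/
def ofLocalField : LogShellContainer.{u} :=
  letI : MeasurableSpace K := borel K
  haveI : BorelSpace K := ⟨rfl⟩
  { carrier := K, Λ := unitBallStructure K }

/-- The carrier of `ofLocalField k` is `k`. [claim: Mochizuki2012, status: disputed] -/
@[simp] theorem ofLocalField_carrier : (ofLocalField K).carrier = K := rfl

/-- The integral structure of `ofLocalField k` is the closed unit ball. [claim: Mochizuki2012, status: disputed] -/
@[simp] theorem coe_ofLocalField_Λ : ((ofLocalField K).Λ : Set (ofLocalField K).carrier) = closedBall (0 : K) 1 :=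
  rfl

/-- **Non-degeneracy I**: every NORM-PRESERVING bicontinuous additive automorphism of `k` (e.g. a continuous
field automorphism `σ ∈ Gal(k/ℚ_p)`, or multiplication by a unit) is a morphism of the container `(k, 𝒪_k)` —
the genuine reading has all the isomorphisms print speaks of, not only identities.
[claim: Mochizuki2012, status: disputed] -/
def isoOfNormPreserving (φ : K ≃ₜ+ K) (hφ : ∀ x, ‖φ x‖ = ‖x‖) : ofLocalField K ⟶ ofLocalField K :=
  ⟨φ, image_closedBall_eq K φ hφ⟩

/-- The underlying isomorphism of `isoOfNormPreserving`. [claim: Mochizuki2012, status: disputed] -/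
@[simp] theorem isoOfNormPreserving_iso (φ : K ≃ₜ+ K) (hφ : ∀ x, ‖φ x‖ = ‖x‖) :
    (isoOfNormPreserving K φ hφ).iso = φ := rfl

/-- **Non-degeneracy II**: `x ↦ −x` is a morphism of the container `(k, 𝒪_k)` (`‖−x‖ = ‖x‖`).
[claim: Mochizuki2012, status: disputed] -/
def negIso : ofLocalField K ⟶ ofLocalField K :=
  isoOfNormPreserving K (negEquiv K) (fun x => by rw [negEquiv_apply, norm_neg])

/-- **Non-degeneracy III**: in characteristic `≠ 2` (e.g. `k ⊇ ℚ_p`), `negIso` is NOT the identity — the genuine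
log-shell category has non-trivial automorphisms, so `prop39ii_genuine` is not an identity-only statement.
[claim: Mochizuki2012, status: disputed] -/
theorem negIso_ne_id (h2 : (2 : K) ≠ 0) : negIso K ≠ 𝟙 (ofLocalField K) := by
  intro h
  have h1 : (negIso K).iso (1 : K) = (𝟙 (ofLocalField K) : ofLocalField K ⟶ ofLocalField K).iso (1 : K) := by
    rw [h]
  change -(1 : K) = 1 at h1
  apply h2
  linear_combination -h1

/-- **IUTchIII:Prop3.9(ii)** (kurims p.116) at a LOCAL FIELD, genuine form: along the FULL poly-isomorphism of the
container `(k, 𝒪_k)` (all bicontinuous additive automorphisms preserving `𝒪_k`) the normalised log-volume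
`μ^log_k` (campaign-S `localLogVolume`) is invariant: `μ^log_k(e(T)) = μ^log_k(T)` for every member `e` and
every region `T`. [claim: Mochizuki2012, status: disputed] -/
theorem localLogVolume_eq_of_hom (f : ofLocalField K ⟶ ofLocalField K) (T : Set K) :
    (ofLocalField K).Λ.logVolume (f.iso '' T) = (ofLocalField K).Λ.logVolume T :=
  logVolume_image_hom f T

/-- **IUTchIII:Prop3.9(ii)** (kurims p.116) at a local field: abc-iut-L6-t4's predicate for the FULL
poly-isomorphism of `(k, 𝒪_k)`, zero hypotheses. [claim: Mochizuki2012, status: disputed] -/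
theorem prop39ii_localField_full :
    Prop39ii_monoAnalyticCompat
      ((fun e : ofLocalField K ≅ ofLocalField K => (forget.mapIso e).toEquiv) ''
        (Set.univ : PolyIso (ofLocalField K) (ofLocalField K)))
      (ofLocalField K).Λ.logVolume (ofLocalField K).Λ.logVolume :=
  prop39ii_genuine_full (ofLocalField K) (ofLocalField K)

/-- The full poly-isomorphism of `(k, 𝒪_k)` has at least two members in characteristic `≠ 2` (identity and
negation) — the instance above is not vacuous and not a singleton. [claim: Mochizuki2012, status: disputed] -/
theorem two_le_card_full (h2 : (2 : K) ≠ 0) :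
    ∃ e e' : ofLocalField K ≅ ofLocalField K, e ≠ e' :=
  ⟨isoOfHom (negIso K), Iso.refl _, fun h => negIso_ne_id K h2 (by
    have := congrArg Iso.hom h
    simpa using this)⟩

end LocalField

end LogShellContainer

end Literature.IUT.LogThetaLattice

end
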